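import Mathlib.AlgebraicGeometry.AlgebraicCycle.Basic
import Mathlib.AlgebraicGeometry.OrderOfVanishing
import Mathlib.AlgebraicGeometry.FunctionField
import Mathlib.AlgebraicGeometry.Morphisms.ClosedImmersion
import Mathlib.AlgebraicGeometry.Morphisms.Proper
import Mathlib.AlgebraicGeometry.Morphisms.FiniteType
import Mathlib.Topology.LocallyFinsupp
import Mathlib.GroupTheory.QuotientGroup.Defs
import Literature.AlgebraicGeometry.Motives.Varieties
import HarnessLib

-- provenance: harness21/H21/H21/Prelude/MotiveAbstract/Cycles.lean @ e1a0f7a (interim HEAD d8f2665); M5 mechanical rewrite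
/-!
# Cycles, rational equivalence and Chow groups (trunk MotiveAbstract, item C4 `Cycles`)

Dimension-graded algebraic cycles, rational equivalence and Chow groups à la
Fulton, *Intersection Theory*, §§1.2–1.4 (see also Stacks 02QQ–02S1), built on Mathlib's
`AlgebraicGeometry.AlgebraicCycle X ℤ = Function.locallyFinsupp X ℤ` (a cycle is a function on
the points of `X` with locally finite support; a point `z` stands for the closed integral
subscheme `closure {z}`).

## Main definitions

* `Literature.cyclesOfDim X d`, `Literature.cyclesOfCodim X p`: the subgroups of cycles supported on points of
  dimension `d` (`Order.height z = d`) resp. codimension `p` (`Order.coheight z = p`).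
* `Literature.primeCycle z`: the prime cycle `[closure {z}]`.
* `Literature.ClosedSubvariety X`: closed integral subschemes `W ↪ X`; `W.divFun f` / `W.div h f` is the
  principal divisor of `f ∈ K(W)ˣ` pushed to `X` (Mathlib's `Scheme.ord`).
* `Literature.ratTrivial X d`: the subgroup `Rat_d X` generated by the `d`-cycles `div f`;
  `Literature.AlgebraicGeometry.Motives.IsRationallyEquivalent`; `Literature.ChowGroup X d = Z_d X / Rat_d X` (Fulton's `A_d X`).
* `Literature.ChowGroup.pushforward d h f`: proper push-forward for morphisms of schemes locally of finite
  type over a field, via Mathlib's `AlgebraicCycle.map f Order.height Order.height`; the named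
  fact `map_mem_ratTrivial` (Fulton Thm 1.4) is the explicit hypothesis `h`.
* `Literature.AlgebraicGeometry.Motives.algebraicCycleMap_comp`, `Literature.AlgebraicGeometry.Motives.ChowGroup.pushforward_comp_holds`: functoriality
  `(g ∘ f)_* = g_* ∘ f_*` of proper push-forward (Stacks 02R5), proved: closed maps do not raise
  `Order.height` (`height_base_le_of_isClosedMap`) and residue degrees are multiplicative
  (`residueDegree_comp`).

## Design choices

* Mathlib has `AlgebraicCycle`, `AlgebraicCycle.map` (proper push-forward of cycles along
  quasi-compact morphisms), `Scheme.ord`, `Scheme.functionField`, but no rational equivalence and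
  no Chow groups (searched: `ChowGroup`, `rationalEquiv`, `cyclesOfDim` — nothing). We use the
  Mathlib objects directly and add no declaration to Mathlib's namespaces.
* Cycles are graded by **dimension** (`Order.height` of the generic point in the specialisation
  order, i.e. the Krull dimension of its closure), following Fulton Ch. 1 and the weight
  functions of `AlgebraicCycle.map`. Codimension grading `cyclesOfCodim` (Mathlib's convention in
  `Scheme.ord`) is kept for the cohomological side and compared with the dimension grading only for
  smooth projective varieties (`cyclesOfCodim_eq_cyclesOfDim`).
* Rational equivalence is defined on every scheme without constructing `div f` as a locally finite
  cycle and without catenarity: the generators of `Rat_d X` are the `d`-cycles (membership in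
  `cyclesOfDim X d` is *part of* the condition) whose coefficient function is `W.divFun f` for some
  closed subvariety `W` of dimension `d + 1` and `f ≠ 0`. That `div f` is automatically a `d`-cycle
  for schemes locally of finite type over a field is the separate theorem `divFun_mem_cyclesOfDim`.
* Flat pull-back of cycles is not defined in this file; see `Literature.AlgebraicGeometry.Motives.ChowGroup.flatPullback` and
  `Literature.AlgebraicGeometry.Motives.ChowGroup.pushforward_flatPullback` in
  `Literature/AlgebraicGeometry/Motives/SubschemeCycles.lean`. No divisor class group / Picard group here
  (picard_group_line_bundles is deferred); see the docstring of `ChowGroup`.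
-/

universe u

open CategoryTheory AlgebraicGeometry Order

namespace Literature.AlgebraicGeometry.Motives

section Graded

variable (X : Scheme.{u})

/-- The group `Z_d X` of `d`-dimensional cycles on a scheme `X`: cycles `c : AlgebraicCycle X ℤ`
all of whose points `z` with `c z ≠ 0` have `Order.height z = d` in the specialisation order
(i.e. `dim (closure {z}) = d`). Fulton, *Intersection Theory* §1.3; Stacks 02QQ. [folklore] -/
def cyclesOfDim (d : ℕ) : AddSubgroup (AlgebraicCycle X ℤ) where
  carrier := {c | ∀ z, c z ≠ 0 → Order.height z = d}
  zero_mem' := fun z hz ↦ (hz rfl).elim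
  add_mem' := by
    intro a b ha hb z hz
    by_cases h : a z = 0
    · refine hb z ?_
      simpa [h] using hz
    · exact ha z h
  neg_mem' := by
    intro a ha z hz
    exact ha z (by simpa using hz)

/-- The group `Z^p X` of codimension-`p` cycles on a scheme `X`: cycles all of whose points `z`
with `c z ≠ 0` have `Order.coheight z = p` (i.e. `dim 𝒪_{X,z} = p`; Mathlib's convention in
`Scheme.ord`). Fulton, *Intersection Theory* §1.3; Stacks 02QQ. [folklore] -/
def cyclesOfCodim (p : ℕ) : AddSubgroup (AlgebraicCycle X ℤ) where
  carrier := {c | ∀ z, c z ≠ 0 → Order.coheight z = p}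
  zero_mem' := fun z hz ↦ (hz rfl).elim
  add_mem' := by
    intro a b ha hb z hz
    by_cases h : a z = 0
    · refine hb z ?_
      simpa [h] using hz
    · exact ha z h
  neg_mem' := by
    intro a ha z hz
    exact ha z (by simpa using hz)

variable {X}

/-- Membership in `Z_d X`, unfolded. [folklore] -/
lemma mem_cyclesOfDim_iff {d : ℕ} {c : AlgebraicCycle X ℤ} :
    c ∈ cyclesOfDim X d ↔ ∀ z, c z ≠ 0 → Order.height z = d := Iff.rfl

/-- Membership in `Z^p X`, unfolded. [folklore] -/
lemma mem_cyclesOfCodim_iff {p : ℕ} {c : AlgebraicCycle X ℤ} :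
    c ∈ cyclesOfCodim X p ↔ ∀ z, c z ≠ 0 → Order.coheight z = p := Iff.rfl

open scoped Classical in
/-- The prime cycle `[V]` of the closed integral subscheme `V = closure {z}` with generic point
`z`: the cycle taking the value `1` at `z` and `0` elsewhere
(Mathlib's `Function.locallyFinsuppWithin.single z 1`). Fulton, *Intersection Theory* §1.3. [folklore] -/
noncomputable def primeCycle (z : X) : AlgebraicCycle X ℤ :=
  Function.locallyFinsuppWithin.single z 1

/-- The prime cycle of `z` has coefficient `1` at `z`. [folklore] -/
@[simp]
lemma primeCycle_apply_self (z : X) : primeCycle z z = 1 := by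
  classical
  simp [primeCycle, Function.locallyFinsuppWithin.single_apply]

/-- The prime cycle of `z` vanishes away from `z`. [folklore] -/
lemma primeCycle_apply_of_ne {z z' : X} (h : z' ≠ z) : primeCycle z z' = 0 := by
  classical
  simp [primeCycle, Function.locallyFinsuppWithin.single_apply, h]

/-- The prime cycle of a point of dimension `d` is a `d`-cycle. Fulton §1.3. [folklore] -/
lemma primeCycle_mem_cyclesOfDim {z : X} {d : ℕ} (hz : Order.height z = d) :
    primeCycle z ∈ cyclesOfDim X d := by
  intro z' hz'
  by_cases h : z' = z
  · subst h; exact hz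
  · exact (hz' (primeCycle_apply_of_ne h)).elim

/-- The prime cycle of a point of codimension `p` is a codimension-`p` cycle. Fulton §1.3. [folklore] -/
lemma primeCycle_mem_cyclesOfCodim {z : X} {p : ℕ} (hz : Order.coheight z = p) :
    primeCycle z ∈ cyclesOfCodim X p := by
  intro z' hz'
  by_cases h : z' = z
  · subst h; exact hz
  · exact (hz' (primeCycle_apply_of_ne h)).elim

/-- A cycle is *effective* if all its coefficients are nonnegative (`0 ≤ c` for Mathlib's
pointwise order on `Function.locallyFinsupp`). Fulton, *Intersection Theory* §1.3. [folklore] -/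
def IsEffectiveCycle (c : AlgebraicCycle X ℤ) : Prop := 0 ≤ c

/-- Prime cycles are effective (Fulton §1.3). [folklore] -/
lemma isEffectiveCycle_primeCycle (z : X) : IsEffectiveCycle (primeCycle z) := by
  classical
  simpa [IsEffectiveCycle, primeCycle] using
    (Function.locallyFinsuppWithin.single_pos_int_one (x := z)).le

end Graded

/-! ## Closed subvarieties and principal divisors -/

/-- A closed subvariety of a scheme `X`: an integral scheme `carrier` together with a closed
immersion `ι : carrier ⟶ X`. (Closed integral subschemes up to the evident notion of isomorphism;
Fulton, *Intersection Theory* §1.2; Hartshorne II.3.) [folklore] -/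
structure ClosedSubvariety (X : Scheme.{u}) where
  /-- The underlying integral scheme. -/
  carrier : Scheme.{u}
  /-- The closed immersion into `X`. -/
  ι : carrier ⟶ X
  /-- `ι` is a closed immersion. -/
  [isClosedImmersion : IsClosedImmersion ι]
  /-- The subvariety is integral. -/
  [isIntegral : IsIntegral carrier]

namespace ClosedSubvariety

attribute [instance] isClosedImmersion isIntegral

variable {X : Scheme.{u}} (W : ClosedSubvariety X)

/-- The generic point of a closed subvariety, as a point of the ambient scheme. [folklore] -/
noncomputable def genericPoint : X := W.ι.base (_root_.genericPoint W.carrier)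

/-- The dimension of a closed subvariety `W ⊆ X`: the height of its generic point in the
specialisation order of `X`, i.e. the Krull dimension of the closed subset `W` (in `ℕ∞`).
Fulton §1.2. [folklore] -/
noncomputable def dim : ℕ∞ := Order.height W.genericPoint

/-- The codimension of a closed subvariety `W ⊆ X`: the coheight of its generic point, i.e.
`dim 𝒪_{X,W}` (in `ℕ∞`). Hartshorne II Ex. 3.20. [folklore] -/
noncomputable def codim : ℕ∞ := Order.coheight W.genericPoint

/-- The closed immersion of a closed subvariety is injective on points. [folklore] -/
lemma ι_base_injective : Function.Injective W.ι.base := W.ι.isClosedEmbedding.injective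

open scoped Classical in
/-- The coefficient function of the principal divisor `div f` of `f ∈ K(W)` pushed forward to
`X`: at a point `z = ι w` of `W` it is Mathlib's order of vanishing `Scheme.ord f w` (which is
`0` unless `w` has codimension one in `W`, and `0` for `f = 0`), and `0` off `W`. The witness
`h.choose` is the unique preimage since `ι` is injective (`divFun_ι_base`).
Fulton, *Intersection Theory* §1.2–1.3; Stacks 02RL. [folklore] -/
noncomputable def divFun [IsLocallyNoetherian W.carrier] (f : W.carrier.functionField) : X → ℤ :=
  fun z ↦ if h : ∃ w, W.ι.base w = z then Scheme.ord f h.choose else 0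

/-- On `W`, `divFun f` is Mathlib's order of vanishing `Scheme.ord f`. [folklore] -/
lemma divFun_ι_base [IsLocallyNoetherian W.carrier] (f : W.carrier.functionField)
    (w : W.carrier) : W.divFun f (W.ι.base w) = Scheme.ord f w := by
  have h : ∃ w', W.ι.base w' = W.ι.base w := ⟨w, rfl⟩
  simp only [divFun, dif_pos h]
  congr 1
  exact W.ι_base_injective h.choose_spec

/-- `divFun f` vanishes off `W`. [folklore] -/
lemma divFun_of_notMem_range [IsLocallyNoetherian W.carrier] (f : W.carrier.functionField)
    {z : X} (hz : z ∉ Set.range W.ι.base) : W.divFun f z = 0 := by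
  have h : ¬ ∃ w, W.ι.base w = z := hz
  simp only [divFun, dif_neg h]

/-- `div 0 = 0` (junk value of `Scheme.ord`). [folklore] -/
@[simp]
lemma divFun_zero [IsLocallyNoetherian W.carrier] : W.divFun 0 = 0 := by
  ext z
  simp only [divFun, Scheme.ord_zero, Pi.zero_apply, dite_eq_ite, ite_self]

/-- The principal divisor of `f ∈ K(W)ˣ` has locally finite support on `X`: on a locally
Noetherian integral scheme a nonzero rational function has nonzero order at only locally finitely
many codimension-one points (Stacks, Divisors, Lemma 31.27.4 = Tag 02RL; Fulton §1.2). [cite: StacksProject, Tag 02RL] -/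
def locallyFiniteSupport_divFun : Prop :=
  ∀ [IsLocallyNoetherian W.carrier] (f : W.carrier.functionField),
    LocallyFiniteSupport (W.divFun f)

/-- The principal divisor `div f ∈ Z_* X` of `f ∈ K(W)` for a closed subvariety `W ⊆ X`, as an
algebraic cycle on `X` (Fulton §1.3, `[div(r)]`). Relies on the named fact
`locallyFiniteSupport_divFun`, taken as the explicit hypothesis `h`. [folklore] -/
noncomputable def div [IsLocallyNoetherian W.carrier] (h : W.locallyFiniteSupport_divFun)
    (f : W.carrier.functionField) : AlgebraicCycle X ℤ where
  toFun := W.divFun f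
  supportWithinDomain' := Set.subset_univ _
  supportLocallyFiniteWithinDomain' z _ := h f z

/-- The coefficients of `div f` are given by `divFun f`. [folklore] -/
@[simp]
lemma div_apply [IsLocallyNoetherian W.carrier] (h : W.locallyFiniteSupport_divFun)
    (f : W.carrier.functionField) (z : X) : W.div h f z = W.divFun f z := rfl

end ClosedSubvariety

/-! ## Rational equivalence and Chow groups -/

section Rat

variable (X : Scheme.{u}) (d : ℕ)

/-- The generators of `Rat_d X`: the `d`-cycles `c` whose coefficient function is `div f` for a
closed subvariety `W ⊆ X` of dimension `d + 1` (with `W` locally Noetherian, so that orders of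
vanishing make sense) and a nonzero rational function `f ∈ K(W)`. Membership in `Z_d X` is part
of the condition (it is automatic for schemes locally of finite type over a field,
`divFun_mem_cyclesOfDim`, but not on non-catenary schemes). Fulton §1.3. [folklore] -/
def ratEquivGenerators : Set (AlgebraicCycle X ℤ) :=
  {c | c ∈ cyclesOfDim X d ∧ ∃ (W : ClosedSubvariety X) (_ : IsLocallyNoetherian W.carrier)
    (f : W.carrier.functionField), f ≠ 0 ∧ W.dim = d + 1 ∧ ⇑c = W.divFun f}

/-- The group `Rat_d X ≤ Z_d X` of `d`-cycles rationally equivalent to zero: the subgroup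
generated by `ratEquivGenerators X d`. Fulton, *Intersection Theory* §1.3; Stacks 02S0. [folklore] -/
def ratTrivial : AddSubgroup (AlgebraicCycle X ℤ) := AddSubgroup.closure (ratEquivGenerators X d)

/-- The generators of `Rat_d X` are `d`-cycles, by definition. [folklore] -/
lemma ratEquivGenerators_subset : ratEquivGenerators X d ⊆ cyclesOfDim X d := fun _ h ↦ h.1

/-- `Rat_d X ≤ Z_d X` (true on every scheme, by construction). [folklore] -/
lemma ratTrivial_le_cyclesOfDim : ratTrivial X d ≤ cyclesOfDim X d :=
  (AddSubgroup.closure_le _).mpr (ratEquivGenerators_subset X d)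

variable {X}

/-- Two cycles are *rationally equivalent* (as `d`-cycles) if their difference lies in `Rat_d X`.
Fulton §1.3. [folklore] -/
def IsRationallyEquivalent (c c' : AlgebraicCycle X ℤ) (d : ℕ) : Prop := c - c' ∈ ratTrivial X d

variable {d}

/-- Rational equivalence is reflexive. [folklore] -/
lemma IsRationallyEquivalent.refl (c : AlgebraicCycle X ℤ) : IsRationallyEquivalent c c d := by
  simp [IsRationallyEquivalent]

/-- Rational equivalence is symmetric. [folklore] -/
lemma IsRationallyEquivalent.symm {c c' : AlgebraicCycle X ℤ} (h : IsRationallyEquivalent c c' d) :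
    IsRationallyEquivalent c' c d := by
  simpa [IsRationallyEquivalent] using (ratTrivial X d).neg_mem h

/-- Rational equivalence is transitive. [folklore] -/
lemma IsRationallyEquivalent.trans {c c' c'' : AlgebraicCycle X ℤ}
    (h : IsRationallyEquivalent c c' d) (h' : IsRationallyEquivalent c' c'' d) :
    IsRationallyEquivalent c c'' d := by
  simpa [IsRationallyEquivalent] using (ratTrivial X d).add_mem h h'

/-- On a scheme locally of finite type over a field, `div f` for `f ∈ K(W)ˣ` and `W ⊆ X` a closed
subvariety of dimension `d + 1` is a `d`-cycle: every codimension-one point of `W` has closure of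
dimension `dim W - 1` (dimension theory of varieties, Stacks 02JU, 0A21; Fulton §1.2). This is
exactly the step that fails on non-catenary schemes, whence the dimension grading and the
built-in membership condition in `ratEquivGenerators` (whose hypotheses, including the redundant
`f ≠ 0` — for `f = 0`, `divFun 0 = 0` — this statement mirrors). [cite: StacksProject, Tags 02JU and 0A21] -/
def divFun_mem_cyclesOfDim : Prop :=
  ∀ {k : Type u} [Field k] (X : SchemeOver k) [LocallyOfFiniteType X.hom] (W : ClosedSubvariety X.left)
    [IsLocallyNoetherian W.carrier] {d : ℕ} {f : W.carrier.functionField},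
    W.dim = d + 1 → f ≠ 0 → ∀ c : AlgebraicCycle X.left ℤ, ⇑c = W.divFun f → c ∈ cyclesOfDim X.left d

variable (X d)

/-- The Chow group `CH_d X = A_d X := Z_d X / Rat_d X` of `d`-cycles modulo rational equivalence.
Fulton, *Intersection Theory* §1.3; Stacks 02S0. For a smooth projective variety `X` of
dimension `n` over a field, `CH_{n-1} X = CH¹ X ≅ Pic X` (Hartshorne II.6.16); this comparison
and the Picard group are not formalised here. [folklore] -/
def ChowGroup : Type u := ↥(cyclesOfDim X d) ⧸ (ratTrivial X d).addSubgroupOf (cyclesOfDim X d)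

namespace ChowGroup

/-- `CH_d X` is an abelian group (quotient group structure from Mathlib). [folklore] -/
noncomputable instance : AddCommGroup (ChowGroup X d) :=
  inferInstanceAs (AddCommGroup (↥(cyclesOfDim X d) ⧸ (ratTrivial X d).addSubgroupOf _))

/-- `CH_d X` is inhabited by `0`. [folklore] -/
noncomputable instance : Inhabited (ChowGroup X d) := ⟨0⟩

/-- The class `[c] ∈ CH_d X` of a `d`-cycle. [folklore] -/
noncomputable def mk : ↥(cyclesOfDim X d) →+ ChowGroup X d := QuotientAddGroup.mk' _

variable {X d}

/-- The class `[V] ∈ CH_d X` of the closed integral subscheme with generic point `z` of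
dimension `d`. Fulton §1.3. [folklore] -/
noncomputable def ofPoint (z : X) (hz : Order.height z = d) : ChowGroup X d :=
  mk X d ⟨primeCycle z, primeCycle_mem_cyclesOfDim hz⟩

/-- Every class in `CH_d X` is the class of a `d`-cycle. [folklore] -/
lemma mk_surjective : Function.Surjective (mk X d) := QuotientAddGroup.mk'_surjective _

/-- Induction principle for `CH_d X`: it suffices to treat classes of `d`-cycles. [folklore] -/
@[elab_as_elim]
lemma induction_on {motive : ChowGroup X d → Prop} (x : ChowGroup X d)
    (h : ∀ c : ↥(cyclesOfDim X d), motive (mk X d c)) : motive x :=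
  QuotientAddGroup.induction_on x h

/-- Two `d`-cycles have the same class in `CH_d X` iff they are rationally equivalent
(Fulton §1.3). [folklore] -/
lemma mk_eq_mk_iff {c c' : ↥(cyclesOfDim X d)} :
    mk X d c = mk X d c' ↔ IsRationallyEquivalent (c : AlgebraicCycle X ℤ) c' d := by
  change (QuotientAddGroup.mk c :
      ↥(cyclesOfDim X d) ⧸ (ratTrivial X d).addSubgroupOf (cyclesOfDim X d)) =
    QuotientAddGroup.mk c' ↔ _
  rw [QuotientAddGroup.eq_iff_sub_mem, AddSubgroup.mem_addSubgroupOf]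
  rfl

/-- A `d`-cycle has zero class in `CH_d X` iff it lies in `Rat_d X`. [folklore] -/
lemma mk_eq_zero_iff {c : ↥(cyclesOfDim X d)} :
    mk X d c = 0 ↔ (c : AlgebraicCycle X ℤ) ∈ ratTrivial X d := by
  change (QuotientAddGroup.mk c :
      ↥(cyclesOfDim X d) ⧸ (ratTrivial X d).addSubgroupOf (cyclesOfDim X d)) = 0 ↔ _
  rw [QuotientAddGroup.eq_zero_iff, AddSubgroup.mem_addSubgroupOf]

end ChowGroup

end Rat

/-! ## Proper push-forward -/

section Pushforward

variable {X Y Z : Scheme.{u}}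

/-- On a quasi-compact morphism, each fibre meets the support of a cycle in a finite set. [folklore] -/
lemma finite_preimage_singleton_inter_support (f : X ⟶ Y) [QuasiCompact f]
    (c : AlgebraicCycle X ℤ) (y : Y) : (f.base ⁻¹' {y} ∩ Function.support c).Finite := by
  obtain ⟨U, ⟨hUo, hUc⟩, hyU, -⟩ :=
    (PrespectralSpace.isTopologicalBasis (X := Y)).exists_subset_of_mem_open
      (Set.mem_univ y) isOpen_univ
  refine (c.locallyFiniteSupport.finite_inter_support_of_isCompact
    (f.isSpectralMap.2 hUo hUc)).subset ?_
  rintro x ⟨hx, hx'⟩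
  exact ⟨show f.base x ∈ U by rwa [show f.base x = y from hx], hx'⟩

/-- Push-forward of cycles is additive (Mathlib's `AlgebraicCycle.map` is not yet bundled). [folklore] -/
lemma algebraicCycleMap_add (f : X ⟶ Y) [QuasiCompact f] {N : Type*} [DecidableEq N]
    (wx : X → N) (wy : Y → N) (c c' : AlgebraicCycle X ℤ) :
    AlgebraicCycle.map f wx wy (c + c') =
      AlgebraicCycle.map f wx wy c + AlgebraicCycle.map f wx wy c' := by
  ext y
  simp only [AlgebraicCycle.map, Function.locallyFinsuppWithin.coe_add, Pi.add_apply,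
    Function.locallyFinsupp.map_apply, add_mul]
  refine finsum_mem_add_distrib' ?_ ?_
  · exact (finite_preimage_singleton_inter_support f c y).subset
      (Set.inter_subset_inter_right _ (Function.support_mul_subset_left _ _))
  · exact (finite_preimage_singleton_inter_support f c' y).subset
      (Set.inter_subset_inter_right _ (Function.support_mul_subset_left _ _))

/-- Push-forward of the zero cycle is zero. [folklore] -/
@[simp]
lemma algebraicCycleMap_zero (f : X ⟶ Y) [QuasiCompact f] {N : Type*} [DecidableEq N]
    (wx : X → N) (wy : Y → N) : AlgebraicCycle.map f wx wy (0 : AlgebraicCycle X ℤ) = 0 := by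
  ext y
  simp [AlgebraicCycle.map]

/-- Push-forward along a quasi-compact morphism (with the dimension weights `Order.height`)
preserves `d`-cycles, on every scheme: `AlgebraicCycle.mapCoeff` kills the points whose image
has a different dimension. Fulton §1.4; Stacks 02R3. [folklore] -/
lemma map_mem_cyclesOfDim (f : X ⟶ Y) [QuasiCompact f] {d : ℕ} {c : AlgebraicCycle X ℤ}
    (hc : c ∈ cyclesOfDim X d) :
    AlgebraicCycle.map f Order.height Order.height c ∈ cyclesOfDim Y d := by
  intro y hy
  simp only [AlgebraicCycle.map, Function.locallyFinsupp.map_apply] at hy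
  obtain ⟨x, hx, hx'⟩ := exists_ne_zero_of_finsum_mem_ne_zero hy
  have hcx : c x ≠ 0 := fun h ↦ hx' (by simp [h])
  have hw : Order.height x = Order.height (f.base x) := by
    by_contra h
    exact hx' (by simp [AlgebraicCycle.mapCoeff, h])
  rw [Set.mem_preimage, Set.mem_singleton_iff] at hx
  rw [← hx, ← hw, hc x hcx]

variable (d : ℕ)

/-- Push-forward of `d`-cycles along a quasi-compact morphism, as a homomorphism
`Z_d X →+ Z_d Y` (Mathlib's `AlgebraicCycle.map f Order.height Order.height` restricted to
`cyclesOfDim`). Fulton §1.4. [folklore] -/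
noncomputable def cyclesOfDimMap (f : X ⟶ Y) [QuasiCompact f] :
    ↥(cyclesOfDim X d) →+ ↥(cyclesOfDim Y d) where
  toFun c := ⟨AlgebraicCycle.map f Order.height Order.height c, map_mem_cyclesOfDim f c.2⟩
  map_zero' := Subtype.ext (algebraicCycleMap_zero f _ _)
  map_add' c c' := Subtype.ext (algebraicCycleMap_add f _ _ c c')

/-- `cyclesOfDimMap` is `AlgebraicCycle.map` on underlying cycles. [folklore] -/
@[simp]
lemma coe_cyclesOfDimMap (f : X ⟶ Y) [QuasiCompact f] (c : ↥(cyclesOfDim X d)) :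
    (cyclesOfDimMap d f c : AlgebraicCycle Y ℤ) = AlgebraicCycle.map f Order.height Order.height c :=
  rfl

variable {k : Type u} [Field k]

/-- **Proper push-forward preserves rational equivalence** (Stacks, Chow Homology, Lemma 42.20.3 =
Tag 02S2, for schemes locally of finite type over `(Spec k, δ = trdeg)`; Fulton, *Intersection
Theory*, Thm 1.4 is the finite-type case). For a proper morphism `f : X ⟶ Y` of schemes locally of
finite type over a field, proper push-forward sends `Rat_d X` into `Rat_d Y`:
`f_* [div r] = [div N(r)]` if `W → f(W)` is generically finite and `0` otherwise (generator-wise,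
Stacks Lemma 42.18.1). [cite: StacksProject, Tag 02S2] -/
def map_mem_ratTrivial : Prop :=
  ∀ {X Y : SchemeOver k} (f : X ⟶ Y) [IsProper f.left] [LocallyOfFiniteType X.hom] [LocallyOfFiniteType Y.hom]
    {c : AlgebraicCycle X.left ℤ},
    c ∈ ratTrivial X.left d → AlgebraicCycle.map f.left Order.height Order.height c ∈ ratTrivial Y.left d

/-- Proper push-forward on Chow groups `f_* : CH_d X →+ CH_d Y` for a proper morphism of schemes
locally of finite type over a field `k` (Fulton §1.4). Relies on the named fact
`map_mem_ratTrivial` (Fulton Thm 1.4), taken as the explicit hypothesis `h`. [folklore] -/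
noncomputable def ChowGroup.pushforward (h : map_mem_ratTrivial d (k := k)) {X Y : SchemeOver k}
    (f : X ⟶ Y) [IsProper f.left] [LocallyOfFiniteType X.hom] [LocallyOfFiniteType Y.hom] :
    ChowGroup X.left d →+ ChowGroup Y.left d :=
  QuotientAddGroup.map _ _ (cyclesOfDimMap d f.left) fun c hc ↦ by
    rw [AddSubgroup.mem_comap, AddSubgroup.mem_addSubgroupOf, coe_cyclesOfDimMap]
    exact h f (AddSubgroup.mem_addSubgroupOf.mp hc)

/-- `f_* [c] = [f_* c]`. [folklore] -/
@[simp]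
lemma ChowGroup.pushforward_mk (h : map_mem_ratTrivial d (k := k)) {X Y : SchemeOver k}
    (f : X ⟶ Y) [IsProper f.left] [LocallyOfFiniteType X.hom] [LocallyOfFiniteType Y.hom]
    (c : ↥(cyclesOfDim X.left d)) :
    ChowGroup.pushforward d h f (ChowGroup.mk X.left d c) =
      ChowGroup.mk Y.left d (cyclesOfDimMap d f.left c) :=
  rfl

/-- Functoriality of proper push-forward, `(g ∘ f)_* = g_* ∘ f_*`, for schemes locally of finite
type over a field (Stacks, Chow Homology, Lemma 42.12.2 = Tag 02R5, via multiplicativity of residue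
degrees; Fulton §1.4 for the finite-type case), for the push-forward built from any witness `h` of
`map_mem_ratTrivial`. [cite: StacksProject, Tag 02R5] -/
def ChowGroup.pushforward_comp : Prop :=
  ∀ (h : map_mem_ratTrivial d (k := k)) {X Y Z : SchemeOver k} (f : X ⟶ Y) (g : Y ⟶ Z)
    [IsProper f.left] [IsProper g.left] [IsProper (f ≫ g).left]
    [LocallyOfFiniteType X.hom] [LocallyOfFiniteType Y.hom] [LocallyOfFiniteType Z.hom],
    ChowGroup.pushforward d h (f ≫ g) =
      (ChowGroup.pushforward d h g).comp (ChowGroup.pushforward d h f)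

end Pushforward

/-! ## Codimension versus dimension for smooth projective varieties -/

/-- On a smooth projective variety of dimension `n` over a field, a point has codimension `p` iff
it has dimension `n - p`, so `Z^p X = Z_{n-p} X`.  This is the **special case** (smooth projective,
geometrically irreducible ⇒ integral of finite type) of Hartshorne II Ex. 3.20 (e), which gives
`dim Y + codim(Y, X) = dim X` for every closed irreducible `Y` in any integral scheme `X` of finite
type over `k` (varieties are catenary and equidimensional; Stacks 02JW); only the smooth
projective form, the one consumed by the cohomological files, is vendored here. [cite: Hartshorne1977, II Ex. 3.20 (e)] -/
def cyclesOfCodim_eq_cyclesOfDim : Prop :=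
  ∀ {k : Type u} [Field k] {n : ℕ} {X : SchemeOver k}, IsSmoothProjective n X → ∀ {p d : ℕ}, p + d = n →
    cyclesOfCodim X.left p = cyclesOfDim X.left d

/-! ## Functoriality of proper push-forward (Stacks 02R5) -/

section PushforwardComp

variable {X Y Z : Scheme.{u}}

/-- Along a closed continuous map, specialisations of `f x` lift to specialisations of `x`:
`closure {f x} = f (closure {x})`. [folklore] -/
lemma exists_le_base_eq_of_isClosedMap (f : X ⟶ Y) (hf : IsClosedMap f.base) {x : X} {y : Y}
    (h : y ≤ f.base x) : ∃ x' ≤ x, f.base x' = y := by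
  have hy : y ∈ closure {f.base x} := (Scheme.le_iff_specializes.mp h).mem_closure
  have hsub : closure {f.base x} ⊆ f.base '' closure {x} :=
    closure_minimal (Set.singleton_subset_iff.mpr ⟨x, subset_closure rfl, rfl⟩)
      (hf _ isClosed_closure)
  obtain ⟨x', hx', rfl⟩ := hsub hy
  exact ⟨x', Scheme.le_iff_specializes.mpr (specializes_iff_mem_closure.mpr hx'), rfl⟩

/-- Along a closed continuous map, strict specialisations of `f x` lift to strict specialisations
of `x`. [folklore] -/
lemma exists_lt_base_eq_of_isClosedMap (f : X ⟶ Y) (hf : IsClosedMap f.base) {x : X} {y : Y}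
    (h : y < f.base x) : ∃ x' < x, f.base x' = y := by
  obtain ⟨x', hx', rfl⟩ := exists_le_base_eq_of_isClosedMap f hf h.le
  refine ⟨x', lt_of_le_not_ge hx' fun h' ↦ h.not_ge ?_, rfl⟩
  exact Scheme.le_iff_specializes.mpr ((Scheme.le_iff_specializes.mp h').map f.continuous)

/-- A closed continuous map does not increase the dimension of point closures:
`dim closure {f x} ≤ dim closure {x}`, i.e. `Order.height (f x) ≤ Order.height x` in the
specialisation order (chains of specialisations of `f x` lift along `f`). This is the topological
input for "both sides vanish when the dimension drops" in Stacks 02R5. [folklore] -/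
lemma height_base_le_of_isClosedMap (f : X ⟶ Y) (hf : IsClosedMap f.base) (x : X) :
    height (f.base x) ≤ height x := by
  suffices H : ∀ n : ℕ, ∀ x : X, (n : ℕ∞) ≤ height (f.base x) → (n : ℕ∞) ≤ height x from
    ENat.forall_natCast_le_iff_le.mp fun n hn ↦ H n x hn
  intro n
  induction n with
  | zero => exact fun x _ ↦ by simp
  | succ n ih =>
    intro x hx
    obtain ⟨p, hlast, hlen⟩ := exists_series_of_le_height _ hx
    have hne : p.length ≠ 0 := by omega
    have hlt : p.eraseLast.last < f.base x := hlast ▸ p.eraseLast_last_rel_last hne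
    obtain ⟨x', hx'x, hx'⟩ := exists_lt_base_eq_of_isClosedMap f hf hlt
    have h1 : (n : ℕ∞) ≤ height (f.base x') := by
      rw [hx']
      refine le_trans ?_ (length_le_height_last (p := p.eraseLast))
      simp [hlen]
    calc ((n + 1 : ℕ) : ℕ∞) = n + 1 := by push_cast; rfl
      _ ≤ height x' + 1 := by gcongr; exact ih x' h1
      _ ≤ height x := height_add_one_le hx'x

/-- **Multiplicativity of residue degrees**: `[κ(x) : κ(g f x)] = [κ(x) : κ(f x)] [κ(f x) : κ(g f x)]`
(tower law `Module.finrank_mul_finrank`; with Mathlib's junk value `0` for infinite degree on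
both sides). Stacks 02R5, proof. [folklore] -/
lemma residueDegree_comp (f : X ⟶ Y) (g : Y ⟶ Z) (x : X) :
    (f ≫ g).residueDegree x = f.residueDegree x * g.residueDegree (f.base x) := by
  letI a1 : Algebra (Z.residueField (g.base (f.base x))) (Y.residueField (f.base x)) :=
    (g.residueFieldMap (f.base x)).hom.toAlgebra
  letI a2 : Algebra (Y.residueField (f.base x)) (X.residueField x) :=
    (f.residueFieldMap x).hom.toAlgebra
  letI a3 : Algebra (Z.residueField (g.base (f.base x))) (X.residueField x) :=
    ((f ≫ g).residueFieldMap x).hom.toAlgebra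
  haveI : IsScalarTower (Z.residueField (g.base (f.base x))) (Y.residueField (f.base x))
      (X.residueField x) :=
    IsScalarTower.of_algebraMap_eq' <|
      show ((f ≫ g).residueFieldMap x).hom =
          (f.residueFieldMap x).hom.comp (g.residueFieldMap (f.base x)).hom by
        rw [Scheme.residueFieldMap_comp]
        rfl
  change Module.finrank (Z.residueField (g.base (f.base x))) (X.residueField x) =
    Module.finrank (Y.residueField (f.base x)) (X.residueField x) *
      Module.finrank (Z.residueField (g.base (f.base x))) (Y.residueField (f.base x))
  rw [mul_comm]
  exact (Module.finrank_mul_finrank _ _ _).symm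

/-- Pointwise multiplicativity of the push-forward coefficients with the dimension weights along
closed morphisms: since `height (g f x) ≤ height (f x) ≤ height x`, either `height x = height (g f x)`
and all three agree (then residue degrees multiply), or both sides vanish. Stacks 02R5, proof.
[folklore] -/
lemma mapCoeff_comp_height (f : X ⟶ Y) (g : Y ⟶ Z) (hf : IsClosedMap f.base)
    (hg : IsClosedMap g.base) (x : X) :
    AlgebraicCycle.mapCoeff (f ≫ g) height height x =
      AlgebraicCycle.mapCoeff f height height x *
        AlgebraicCycle.mapCoeff g height height (f.base x) := by
  have h1 := height_base_le_of_isClosedMap f hf x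
  have h2 := height_base_le_of_isClosedMap g hg (f.base x)
  simp only [AlgebraicCycle.mapCoeff]
  rw [Scheme.Hom.comp_apply]
  by_cases h : height x = height (g.base (f.base x))
  · have h' : height (f.base x) = height (g.base (f.base x)) := le_antisymm (h ▸ h1) h2
    have h'' : height x = height (f.base x) := h.trans h'.symm
    rw [if_pos h, if_pos h'', if_pos h', residueDegree_comp]
  · rw [if_neg h]
    by_cases h'' : height x = height (f.base x)
    · have h' : ¬ height (f.base x) = height (g.base (f.base x)) := fun e ↦ h (h''.trans e)
      rw [if_neg h', mul_zero]
    · rw [if_neg h'', zero_mul]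

/-- Fibrewise decomposition of a finite sum over a fibre of a composite map. [folklore] -/
lemma finsum_mem_preimage_comp {α β γ M : Type*} [AddCommMonoid M] (f : α → β) (g : β → γ)
    (F : α → M) (z : γ) (hfin : ((g ∘ f) ⁻¹' {z} ∩ Function.support F).Finite) :
    ∑ᶠ x ∈ (g ∘ f) ⁻¹' {z}, F x = ∑ᶠ y ∈ g ⁻¹' {z}, ∑ᶠ x ∈ f ⁻¹' {y}, F x := by
  classical
  set S := hfin.toFinset with hS
  have hmem : ∀ x, x ∈ S ↔ g (f x) = z ∧ F x ≠ 0 := fun x ↦ by simp [hS]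
  have hL : ∑ᶠ x ∈ (g ∘ f) ⁻¹' {z}, F x = ∑ x ∈ S, F x :=
    finsum_mem_eq_sum_of_subset _ (by simp [hS]) fun x hx ↦ ((hmem x).mp hx).1
  have hinner : ∀ y ∈ g ⁻¹' {z}, ∑ᶠ x ∈ f ⁻¹' {y}, F x = ∑ x ∈ S with f x = y, F x := by
    intro y hy
    refine finsum_mem_eq_sum_of_subset _ ?_ ?_
    · rintro x ⟨hx, hx'⟩
      have hx : f x = y := hx
      simp only [Finset.coe_filter, Set.mem_setOf_eq, hmem]
      exact ⟨⟨by rw [hx]; exact hy, hx'⟩, hx⟩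
    · intro x hx
      simp only [Finset.coe_filter, Set.mem_setOf_eq] at hx
      exact hx.2
  rw [hL, finsum_mem_congr rfl hinner]
  have hmaps : ∀ x ∈ S, f x ∈ S.image f := fun x hx ↦ Finset.mem_image_of_mem f hx
  rw [finsum_mem_eq_sum_of_subset _ (t := S.image f), Finset.sum_fiberwise_of_maps_to hmaps]
  · rintro y ⟨-, hy⟩
    exact Finset.support_of_fiberwise_sum_subset_image S F f hy
  · intro y hy
    obtain ⟨x, hx, rfl⟩ := Finset.mem_image.mp hy
    exact ((hmem x).mp hx).1

/-- **Functoriality of push-forward of cycles** `(g ∘ f)_* = g_* ∘ f_*` on `Z_* X`, for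
quasi-compact closed morphisms (in particular proper ones), with the dimension weights
`Order.height` (Stacks, Chow Homology, Lemma 42.12.2 = Tag 02R5: multiplicativity of degrees, and
both sides vanish when the dimension drops). [cite: StacksProject, Tag 02R5] -/
lemma algebraicCycleMap_comp (f : X ⟶ Y) (g : Y ⟶ Z) [QuasiCompact f] [QuasiCompact g]
    [QuasiCompact (f ≫ g)] (hf : IsClosedMap f.base) (hg : IsClosedMap g.base)
    (c : AlgebraicCycle X ℤ) :
    AlgebraicCycle.map (f ≫ g) height height c =
      AlgebraicCycle.map g height height (AlgebraicCycle.map f height height c) := by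
  ext z
  simp only [AlgebraicCycle.map, Function.locallyFinsupp.map_apply]
  simp_rw [mapCoeff_comp_height f g hf hg, Nat.cast_mul, ← mul_assoc]
  have hfin : ((g.base ∘ f.base) ⁻¹' {z} ∩ Function.support fun x ↦ c x *
      (AlgebraicCycle.mapCoeff f height height x : ℤ) *
        (AlgebraicCycle.mapCoeff g height height (f.base x) : ℤ)).Finite := by
    refine (finite_preimage_singleton_inter_support (f ≫ g) c z).subset ?_
    refine Set.inter_subset_inter (fun x hx ↦ by simpa using hx) ?_
    exact (Function.support_mul_subset_left _ _).trans (Function.support_mul_subset_left _ _)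
  rw [show ((f ≫ g).base ⁻¹' {z}) = (g.base ∘ f.base) ⁻¹' {z} from by ext; simp,
    finsum_mem_preimage_comp f.base g.base _ z hfin]
  refine finsum_mem_congr rfl fun y hy ↦ ?_
  rw [finsum_mem_mul]
  refine finsum_mem_congr rfl fun x hx ↦ ?_
  rw [show f.base x = y from hx]

variable (d : ℕ) {k : Type u} [Field k]

/-- **Stacks 02R5** for Chow groups: `(g ∘ f)_* = g_* ∘ f_* : CH_d X → CH_d Z` for proper morphisms
of schemes locally of finite type over a field, discharging the named fact
`ChowGroup.pushforward_comp`. The proof follows Stacks, Chow Homology, Lemma 42.12.2 (Tag 02R5):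
on a prime cycle both sides vanish unless the dimension is preserved (here: closed maps do not raise
`Order.height`, `height_base_le_of_isClosedMap`), and then the residue degrees multiply
(`residueDegree_comp`). [cite: StacksProject, Tag 02R5] -/
theorem ChowGroup.pushforward_comp_holds : ChowGroup.pushforward_comp d (k := k) := by
  intro h X Y Z f g _ _ _ _ _ _
  ext x
  induction x using ChowGroup.induction_on with
  | h c =>
    simp only [AddMonoidHom.comp_apply, ChowGroup.pushforward_mk]
    congr 1
    apply Subtype.ext
    simp only [coe_cyclesOfDimMap]
    exact algebraicCycleMap_comp f.left g.left f.left.isClosedMap g.left.isClosedMap c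

end PushforwardComp

end Literature.AlgebraicGeometry.Motives
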